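import Mathlib.Analysis.Normed.Group.Ultra
import Mathlib.Analysis.Normed.Group.Quotient
import Mathlib.Analysis.Normed.Lp.PiLp
import Mathlib.Topology.Algebra.Module.FiniteDimension
import Summits.ABC.IUTFork.Joshi.TensorNorms
import HarnessLib

/-!
# Joshi's §7.6 tensor norms — the cross-norm HYPOTHESES (3)/(3′)/(4) of `Joshi/TensorNorms.lean` for Mathlib's
# projective norm `π_Σ` are FALSE AS TYPED (every prime `p`): a QUOTIENT-norm witness; no side taken

Record file of the abc-iut cell, branch E «type Joshi's construction, test vs S» (rung LADDER-ABC:A2.E; seat abc-iut-E-t39,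
§4-fallback companion to slot T-14 = abc-iut-E-t14's `Joshi/TensorNorms.lean` p429229, imported BY NAME and not edited;
nodes `J3:Thm7.6.2.2 (3)(4)`, `J3:Lem7.6.6.1` of `plan/E/JOSHI-DAG.tsv`). Source: K. Joshi, *Construction of Arithmetic
Teichmuller Spaces III*, arXiv:2401.13508 v4 (unrefereed preprint, cited as such; bib `Joshi2024ATS3`), §7.6.2 «The cross-norm
property», PDF p. 61 l. 12 – p. 62 l. 16 (render `HOME/lit/renders/Joshi-arxiv-2401.13508/pNNNN.txt`). FRAMING: this campaign
LOCATES / CONDITIONALLY VERIFIES; NO abc claim; no side taken on [IUTchIII] Cor. 3.12 or on any author; typed ≠ proved ≠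
endorsed. A refutation of an AS-TYPED hypothesis says NOTHING about [J-III] or its sources: the printed sentences concern
NON-ARCHIMEDEAN Banach spaces (ultrametric norms, [Schneider 2002, §17]) and in that reading (3)/(4) and Lemma 7.6.6.1 are
THEOREMS of the tree (abc-iut-E-t14 `TensorNorm.hasCrossNorm_norm_of_ultrametric`, `norm_tprod_padicField`, p432495;
abc-iut-found `norm_tprod_padic_ultrametric`, p431820).

## Context in the block (sibling files, cited BY NAME, nothing restated)
* `TensorNorm.CrossNormClaim p E` / `CrossNormSeminormedClaim p E` / `CrossNormClaimQp p` (E-t14, `TensorNorms.lean`):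
  Thm 7.6.2.2 (3)/(3′)/(4) typed for Mathlib's projective norm `π_Σ` (`‖⨂ₜ m‖ = ∏ ‖m i‖`) over ALL
  `[NormedAddCommGroup (V i)] [NormedSpace E (V i)]` — Mathlib's `NormedSpace` over a p-adic field does NOT force the norm
  of `V i` to be ultrametric (abc-iut-found's typing flag).
* Already refuted AS TYPED by siblings, with the ℓ¹-plane `(ℚ_p², ℓ¹)`: the `π_max` forms (abc-iut-found
  `not_crossNormMaxClaim_padic`, `not_crossNormMaxSeminormedClaim_padic`) and (2) projective = injective (abc-iut-E-t44
  `not_projEqInjClaim_padic`, p432516). Both seats recorded that the ℓ¹-plane does NOT refute the `π_Σ` claims (3)/(4) —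
  correctly: for «lattice» norms `N = Λ(|f₁|,…,|f_k|)` (ℓ¹-sums of functionals) `π_Σ` IS cross over any valued field
  (apply all `f_a ⊗ f_b` and sum). A counterexample needs an inf-type norm.

## What this file establishes (kernel, standard axioms): (3)/(3′)/(4) for `π_Σ` are FALSE AS TYPED, for EVERY prime `p`
WITNESS: the QUOTIENT `Q = ℓ¹(ℚ_p³) / ℚ_p·(1,1,1)` with its quotient norm — a complete, finite-dimensional, normed `ℚ_p`-space
that is NOT ultrametric (`not_isUltrametricDist_Q3`: `‖e₁‖, ‖e₂‖ ≤ 1` but `‖e₁ − e₂‖ ≥ 1 + |2|_p`). With `u = [(1,−1,0)]`,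
`v = [(0,0,−1)] = e₁ + e₂`, `e₁ = [(1,0,0)]`, `e₂ = [(0,1,0)]` (all of quotient norm `≤ 1` except `u`):
* `tprod_qu_qu`: in `Q ⊗ Q`, `u ⊗ u = v ⊗ v − (2e₁) ⊗ e₂ − (2e₂) ⊗ e₁` (bilinear algebra), hence
  `norm_tprod_qu_le`: `‖u ⊗ u‖ ≤ 1 + 2|2|_p` (triangle inequality + `‖x ⊗ y‖ ≤ ‖x‖ ‖y‖`);
* `le_norm_qu`: `‖u‖ ≥ 1 + |2|_p` (for every `t ∈ ℚ_p`, `|1−t| + |1+t| + |t| ≥ 1 + |2|_p`: ultrametric case split in `ℚ_p`);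
* so `‖u ⊗ u‖ ≤ 1 + 2|2|_p < (1 + |2|_p)² ≤ ‖u‖·‖u‖` and the typed cross-norm identity fails at `m = (u, u)`:
  `not_crossNormClaimQp : ¬ CrossNormClaimQp p`, `not_crossNormClaim_padic : ¬ CrossNormClaim p ℚ_[p]`,
  `not_crossNormSeminormedClaim_padic : ¬ CrossNormSeminormedClaim p ℚ_[p]` (universe level 0).
CLASSIFICATION (cell grammar): MISSTATED-AS-TYPED — the witness exploits the missing side condition «`V i` ultrametric»;
repaired statement C′ = add `[∀ i, IsUltrametricDist (V i)]`, which the witness misses, and C′ is the sibling THEOREM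
`hasCrossNorm_norm_of_ultrametric` — consumers of (3)/(4) (`norm_tprod_of_crossNormClaim`, `norm_tprod_of_crossNormClaimQp`;
the `CrossNorm` input of E-t23/E-t13's chains at `E = ℚ_p`) should take the theorem, not the hypothesis: as typed, the
antecedent is FALSE and the conditional theorems are VACUOUS.

Deliberately NOT here: anything about `B_E`, the loci, or Cor. 3.12; `π_max`; (2); `MulTensorSeminormClaim`. No instance
(the closedness of the diagonal line is a local hypothesis), no notation, no axiom, no `sorry`.
-/

noncomputable section

open scoped TensorProduct
open PiTensorProduct Metric

namespace Summit.ABC.IUTFork.Joshi.TensorNorm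

/-! ## The quotient witness and the refutations (every prime `p`, universe level `0`) -/

section AsTypedRefutation

variable (p : ℕ) [Fact p.Prime]

/-- `|2|_p ≤ 1`. -/
theorem norm_two_le_one : ‖(2 : ℚ_[p])‖ ≤ 1 := by
  have := Padic.norm_int_le_one (p := p) 2
  simpa using this

/-- `0 < |2|_p`. -/
theorem norm_two_pos : 0 < ‖(2 : ℚ_[p])‖ := norm_pos_iff.mpr two_ne_zero

/-- The key estimate behind the quotient-norm lower bound: for every `t ∈ ℚ_p`,
`1 + |2|_p ≤ |1 - t|_p + |1 + t|_p + |t|_p`. -/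
theorem one_add_norm_two_le (t : ℚ_[p]) : 1 + ‖(2 : ℚ_[p])‖ ≤ ‖1 - t‖ + ‖1 + t‖ + ‖t‖ := by
  by_cases ht : ‖t‖ < 1
  · have h1 : ‖(1 : ℚ_[p]) - t‖ = 1 := by
      rw [sub_eq_add_neg, IsUltrametricDist.norm_add_eq_max_of_norm_ne_norm] <;> simp [ht.ne', ht.le]
    have h2 : ‖(1 : ℚ_[p]) + t‖ = 1 := by
      rw [IsUltrametricDist.norm_add_eq_max_of_norm_ne_norm] <;> simp [ht.ne', ht.le]
    rw [h1, h2]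
    linarith [norm_two_le_one p, norm_nonneg t]
  · push Not at ht
    have h3 : ‖(2 : ℚ_[p])‖ ≤ ‖1 - t‖ + ‖1 + t‖ := by
      have : (2 : ℚ_[p]) = (1 - t) + (1 + t) := by ring
      rw [this]; exact norm_add_le _ _
    linarith

/-- The ambient space `ℓ¹(ℚ_p³)` of the first witness. -/
abbrev L13 : Type := PiLp 1 (fun _ : Fin 3 => ℚ_[p])

/-- The diagonal line `ℚ_p · (1,1,1) ⊂ ℓ¹(ℚ_p³)`. -/
def diag : Submodule ℚ_[p] (L13 p) := ℚ_[p] ∙ (WithLp.toLp 1 fun _ => (1 : ℚ_[p]))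

/-- The diagonal line is closed (finite-dimensional subspace over a complete field). -/
theorem isClosed_diag : IsClosed ((diag p : Submodule ℚ_[p] (L13 p)) : Set (L13 p)) := by
  haveI : FiniteDimensional ℚ_[p] (diag p) := by
    unfold diag; infer_instance
  exact (diag p).closed_of_finiteDimensional

/-- THE WITNESS SPACE `Q = ℓ¹(ℚ_p³) / ℚ_p·(1,1,1)` with its quotient norm: a complete normed `ℚ_p`-space that is NOT
ultrametric (`‖e₁‖ = ‖e₂‖ = 1` but `‖e₁ - e₂‖ = 1 + |2|_p > 1`). -/
abbrev Q3 : Type := L13 p ⧸ diag p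

/-- `u = [(1,-1,0)]`. -/
def qu : Q3 p := Submodule.Quotient.mk (WithLp.toLp 1 ![(1 : ℚ_[p]), -1, 0])
/-- `e₁ = [(1,0,0)]`. -/
def qe1 : Q3 p := Submodule.Quotient.mk (WithLp.toLp 1 ![(1 : ℚ_[p]), 0, 0])
/-- `e₂ = [(0,1,0)]`. -/
def qe2 : Q3 p := Submodule.Quotient.mk (WithLp.toLp 1 ![(0 : ℚ_[p]), 1, 0])
/-- `v = [(0,0,-1)] (= e₁ + e₂ in the quotient)`. -/
def qv : Q3 p := Submodule.Quotient.mk (WithLp.toLp 1 ![(0 : ℚ_[p]), 0, -1])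

/-- `‖e₁‖ ≤ 1` (representative `(1,0,0)` of ℓ¹-norm 1). -/
theorem norm_qe1_le : ‖qe1 p‖ ≤ 1 := by
  refine (Submodule.Quotient.norm_mk_le _ _).trans (le_of_eq ?_)
  simp [PiLp.norm_eq_of_L1, Fin.sum_univ_three]

/-- `‖e₂‖ ≤ 1` (representative `(0,1,0)`). -/
theorem norm_qe2_le : ‖qe2 p‖ ≤ 1 := by
  refine (Submodule.Quotient.norm_mk_le _ _).trans (le_of_eq ?_)
  simp [PiLp.norm_eq_of_L1, Fin.sum_univ_three]

/-- `‖v‖ ≤ 1` (representative `(0,0,−1)`). -/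
theorem norm_qv_le : ‖qv p‖ ≤ 1 := by
  refine (Submodule.Quotient.norm_mk_le _ _).trans (le_of_eq ?_)
  simp [PiLp.norm_eq_of_L1, Fin.sum_univ_three]

/-- `u = e₁ − e₂` (exact at the level of representatives). -/
theorem qu_eq : qu p = qe1 p - qe2 p := by
  unfold qu qe1 qe2
  rw [← Submodule.Quotient.mk_sub]
  congr 1
  ext i; fin_cases i <;> simp

/-- `v = e₁ + e₂` in the quotient: `(1,1,0) − (0,0,−1) = (1,1,1)` lies on the diagonal. -/
theorem qv_eq : qv p = qe1 p + qe2 p := by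
  unfold qv qe1 qe2
  rw [← Submodule.Quotient.mk_add, eq_comm, Submodule.Quotient.eq]
  unfold diag
  refine Submodule.mem_span_singleton.mpr ⟨1, ?_⟩
  ext i; fin_cases i <;> simp

/-- Lower bound for the quotient norm of `u`: `1 + |2|_p ≤ ‖u‖`. -/
theorem le_norm_qu : 1 + ‖(2 : ℚ_[p])‖ ≤ ‖qu p‖ := by
  unfold qu
  change 1 + ‖(2 : ℚ_[p])‖ ≤ ‖(QuotientAddGroup.mk (WithLp.toLp 1 ![(1 : ℚ_[p]), -1, 0]) :
    L13 p ⧸ (diag p).toAddSubgroup)‖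
  rw [QuotientAddGroup.norm_mk]
  have hne : ((diag p).toAddSubgroup : Set (L13 p)).Nonempty := ⟨0, (diag p).zero_mem⟩
  refine (le_infDist hne).mpr fun y hy => ?_
  obtain ⟨t, rfl⟩ := Submodule.mem_span_singleton.mp (show y ∈ diag p from hy)
  rw [PiLp.dist_eq_of_L1, Fin.sum_univ_three]
  have e0 : dist ((WithLp.toLp 1 ![(1 : ℚ_[p]), -1, 0] : L13 p) 0)
      ((t • (WithLp.toLp 1 fun _ => (1 : ℚ_[p]) : L13 p)) 0) = ‖1 - t‖ := by
    simp [dist_eq_norm]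
  have e1 : dist ((WithLp.toLp 1 ![(1 : ℚ_[p]), -1, 0] : L13 p) 1)
      ((t • (WithLp.toLp 1 fun _ => (1 : ℚ_[p]) : L13 p)) 1) = ‖1 + t‖ := by
    have : ‖(-1 : ℚ_[p]) - t‖ = ‖1 + t‖ := by
      rw [← norm_neg]; congr 1; ring
    simpa [dist_eq_norm] using this
  have e2 : dist ((WithLp.toLp 1 ![(1 : ℚ_[p]), -1, 0] : L13 p) 2)
      ((t • (WithLp.toLp 1 fun _ => (1 : ℚ_[p]) : L13 p)) 2) = ‖t‖ := by
    simp [dist_eq_norm]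
  rw [e0, e1, e2]
  exact one_add_norm_two_le p t

/-- The witness space is NOT ultrametric: `‖e₁ − e₂‖ = ‖u‖ ≥ 1 + |2|_p > 1 ≥ max ‖e₁‖ ‖e₂‖`. So it lies outside the
printed (non-archimedean) setting — it only tests the statements AS TYPED over Mathlib's `NormedSpace`. -/
theorem not_isUltrametricDist_Q3 : ¬ IsUltrametricDist (Q3 p) := by
  intro h
  have h1 : ‖qe1 p - qe2 p‖ ≤ max ‖qe1 p‖ ‖qe2 p‖ := by
    rw [sub_eq_add_neg]
    refine (IsUltrametricDist.norm_add_le_max _ _).trans (le_of_eq ?_)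
    rw [norm_neg]
  have h2 : max ‖qe1 p‖ ‖qe2 p‖ ≤ 1 := max_le (norm_qe1_le p) (norm_qe2_le p)
  have h3 := le_norm_qu p
  rw [qu_eq] at h3
  linarith [norm_two_pos p]

/-- The tensor identity `u ⊗ u = v ⊗ v − (2e₁) ⊗ e₂ − (2e₂) ⊗ e₁` in `Q ⊗ Q` (pure bilinear algebra; written without
scalars acting on the tensor space). -/
theorem tprod_qu_qu :
    (⨂ₜ[ℚ_[p]] i, (![qu p, qu p] : Fin 2 → Q3 p) i) =
      (⨂ₜ[ℚ_[p]] i, (![qv p, qv p] : Fin 2 → Q3 p) i)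
        - (⨂ₜ[ℚ_[p]] i, (![(2 : ℚ_[p]) • qe1 p, qe2 p] : Fin 2 → Q3 p) i)
        - (⨂ₜ[ℚ_[p]] i, (![(2 : ℚ_[p]) • qe2 p, qe1 p] : Fin 2 → Q3 p) i) := by
  -- the bilinear map `t x y = x ⊗ y`
  set t : Q3 p → Q3 p → ⨂[ℚ_[p]] i : Fin 2, Q3 p := fun x y => ⨂ₜ[ℚ_[p]] i, (![x, y] : Fin 2 → Q3 p) i
    with htdef
  have hupd0 : ∀ (x y z : Q3 p), Function.update (![x, y] : Fin 2 → Q3 p) 0 z = ![z, y] := by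
    intro x y z; ext i; fin_cases i <;> simp
  have hupd1 : ∀ (x y z : Q3 p), Function.update (![x, y] : Fin 2 → Q3 p) 1 z = ![x, z] := by
    intro x y z; ext i; fin_cases i <;> simp
  have hadd_left : ∀ x x' y : Q3 p, t (x + x') y = t x y + t x' y := by
    intro x x' y
    have := (tprod ℚ_[p] (s := fun _ : Fin 2 => Q3 p)).map_update_add ![x, y] 0 x x'
    simpa [htdef, hupd0] using this
  have hsmul_left : ∀ (a : ℚ_[p]) (x y : Q3 p), t (a • x) y = a • t x y := by
    intro a x y
    have := (tprod ℚ_[p] (s := fun _ : Fin 2 => Q3 p)).map_update_smul ![x, y] 0 a x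
    simpa [htdef, hupd0] using this
  have hadd_right : ∀ x y y' : Q3 p, t x (y + y') = t x y + t x y' := by
    intro x y y'
    have := (tprod ℚ_[p] (s := fun _ : Fin 2 => Q3 p)).map_update_add ![x, y] 1 y y'
    simpa [htdef, hupd1] using this
  have hsub_left : ∀ x x' y : Q3 p, t (x - x') y = t x y - t x' y := by
    intro x x' y
    rw [eq_sub_iff_add_eq, ← hadd_left, sub_add_cancel]
  have hsub_right : ∀ x y y' : Q3 p, t x (y - y') = t x y - t x y' := by
    intro x y y'
    rw [eq_sub_iff_add_eq, ← hadd_right, sub_add_cancel]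
  show t (qu p) (qu p) = t (qv p) (qv p) - t ((2 : ℚ_[p]) • qe1 p) (qe2 p) - t ((2 : ℚ_[p]) • qe2 p) (qe1 p)
  rw [hsmul_left, hsmul_left, qu_eq, qv_eq, hsub_left, hsub_right, hsub_right, hadd_left, hadd_right,
    hadd_right, two_smul, two_smul]
  abel

/-- `‖x ⊗ y‖ ≤ ‖x‖ · ‖y‖` in `Q ⊗ Q` (Mathlib `projectiveSeminorm_tprod_le`, two factors). -/
theorem norm_tprod_two_le (x y : Q3 p) :
    ‖(⨂ₜ[ℚ_[p]] i, (![x, y] : Fin 2 → Q3 p) i)‖ ≤ ‖x‖ * ‖y‖ := by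
  refine (projectiveSeminorm_tprod_le _).trans (le_of_eq ?_)
  rw [Fin.prod_univ_two]
  simp only [Matrix.cons_val_zero, Matrix.cons_val_one]

/-- Upper bound: `‖u ⊗ u‖ ≤ 1 + 2 |2|_p` (triangle inequality + `‖x ⊗ y‖ ≤ ‖x‖ ‖y‖`). -/
theorem norm_tprod_qu_le :
    ‖(⨂ₜ[ℚ_[p]] i, (![qu p, qu p] : Fin 2 → Q3 p) i)‖ ≤ 1 + 2 * ‖(2 : ℚ_[p])‖ := by
  rw [tprod_qu_qu]
  set A := (⨂ₜ[ℚ_[p]] i, (![qv p, qv p] : Fin 2 → Q3 p) i) with hA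
  set B := (⨂ₜ[ℚ_[p]] i, (![(2 : ℚ_[p]) • qe1 p, qe2 p] : Fin 2 → Q3 p) i) with hB
  set C := (⨂ₜ[ℚ_[p]] i, (![(2 : ℚ_[p]) • qe2 p, qe1 p] : Fin 2 → Q3 p) i) with hC
  have h4 : 0 ≤ ‖(2 : ℚ_[p])‖ := norm_nonneg _
  have h1 : ‖A‖ ≤ 1 := by
    refine (norm_tprod_two_le p _ _).trans ?_
    calc ‖qv p‖ * ‖qv p‖ ≤ 1 * 1 := mul_le_mul (norm_qv_le p) (norm_qv_le p) (norm_nonneg _) zero_le_one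
      _ = 1 := one_mul 1
  have h2 : ‖B‖ ≤ ‖(2 : ℚ_[p])‖ := by
    refine (norm_tprod_two_le p _ _).trans ?_
    rw [norm_smul]
    calc ‖(2 : ℚ_[p])‖ * ‖qe1 p‖ * ‖qe2 p‖ ≤ ‖(2 : ℚ_[p])‖ * 1 * 1 :=
          mul_le_mul (mul_le_mul_of_nonneg_left (norm_qe1_le p) h4) (norm_qe2_le p) (norm_nonneg _)
            (mul_nonneg h4 zero_le_one)
      _ = ‖(2 : ℚ_[p])‖ := by ring
  have h3 : ‖C‖ ≤ ‖(2 : ℚ_[p])‖ := by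
    refine (norm_tprod_two_le p _ _).trans ?_
    rw [norm_smul]
    calc ‖(2 : ℚ_[p])‖ * ‖qe2 p‖ * ‖qe1 p‖ ≤ ‖(2 : ℚ_[p])‖ * 1 * 1 :=
          mul_le_mul (mul_le_mul_of_nonneg_left (norm_qe2_le p) h4) (norm_qe1_le p) (norm_nonneg _)
            (mul_nonneg h4 zero_le_one)
      _ = ‖(2 : ℚ_[p])‖ := by ring
  have h5 : ‖A - B - C‖ ≤ ‖A - B‖ + ‖C‖ := norm_sub_le (A - B) C
  have h6 : ‖A - B‖ ≤ ‖A‖ + ‖B‖ := norm_sub_le A B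
  linarith

/-- **Thm 7.6.2.2 (4) AS TYPED (`CrossNormClaimQp`) is FALSE for every prime `p`** — witness `Q ⊗ Q`, `Q = ℓ¹(ℚ_p³)/diag`
(complete, normed, NOT ultrametric), `m = (u, u)`: `‖u ⊗ u‖ ≤ 1 + 2|2|_p < (1 + |2|_p)² ≤ ‖u‖ ‖u‖`.
MISSTATED-AS-TYPED: the repaired statement adds `[∀ i, IsUltrametricDist (V i)]` and is then the THEOREM `crossNorm_Qp`;
the witness is not ultrametric (`not_isUltrametricDist_Q3`). Says nothing about [J-III] p. 62 l. 13–14, whose sentence is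
about `ℚ_p`-Banach (ultrametric) spaces. -/
theorem not_crossNormClaimQp : ¬ CrossNormClaimQp.{0, 0} p := by
  intro h
  haveI : IsClosed ((diag p : Submodule ℚ_[p] (L13 p)) : Set (L13 p)) := isClosed_diag p
  have hc : ∀ i : Fin 2, CompleteSpace ((fun _ : Fin 2 => Q3 p) i) := fun _ => inferInstance
  have heq := h inferInstance (Fin 2) (fun _ => Q3 p) hc ![qu p, qu p]
  rw [Fin.prod_univ_two] at heq
  simp only [Matrix.cons_val_zero, Matrix.cons_val_one] at heq
  have hup := norm_tprod_qu_le p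
  rw [heq] at hup
  have hlow := le_norm_qu p
  have h2 := norm_two_pos p
  have : (1 + ‖(2 : ℚ_[p])‖) * (1 + ‖(2 : ℚ_[p])‖) ≤ ‖qu p‖ * ‖qu p‖ :=
    mul_le_mul hlow hlow (by positivity) (norm_nonneg _)
  nlinarith

/-- **Thm 7.6.2.2 (3) AS TYPED (`CrossNormClaim p E`) is FALSE at `E = ℚ_p`**, every prime `p` (same witness). -/
theorem not_crossNormClaim_padic : ¬ CrossNormClaim.{0, 0, 0} p ℚ_[p] :=
  fun h => not_crossNormClaimQp p ((crossNormClaimQp_iff p).mpr h)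

/-- **The completeness-free form (`CrossNormSeminormedClaim p E`) is FALSE at `E = ℚ_p`** (it implies (3)). -/
theorem not_crossNormSeminormedClaim_padic : ¬ CrossNormSeminormedClaim.{0, 0, 0} p ℚ_[p] :=
  fun h => not_crossNormClaim_padic p (crossNormClaim_of_seminormed h)

end AsTypedRefutation

end Summit.ABC.IUTFork.Joshi.TensorNorm

end
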